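import Mathlib
import HarnessLib
import Summits.ResolutionOfSingularities.ResolutionOfSingularities.Theorems.WildQuotientsWildQuotientResolutionS1aGraphShear

/-!
# S1a — SECOND-ORDER TAYLOR EXPANSION of a multivariate polynomial in ONE variable direction: `Q(x + b·eᵢ) = Q(x) + b·(∂ᵢQ)(x) + b²·r`

[OURS · L1 W4.5c · lead-1 g16; plan-1 RULING R-F15p (1) «R4e-rational … at the price of K-LOC + (α1) + a Taylor lemma»: the component row of the GRAPH MEMBER
(✓`exists_isPrincipalCentre_of_symMemberGraph`: `τφ = φ + βX₀·hu + (βX₀)²·r`) for a general graph `φ = x′₂ − G(x′₁, s)` needs `G(x′₁ + βX₀, s) = G + βX₀·∂₁G + (βX₀)²·r`;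
✓`Tmono.exists_add_pow_succ_eq` is the monomial case] — NOT statements of the manuscript; counted 0; AI-level work, weaker than expert review. Crux
stmt-ResolutionOfSingularities-17941 `CyclicQuotientFourfolds`, line `s1a-logminvertex` v13 (`stub_reachLowerInFX`). Pure algebra (folklore).

* `exists_eval₂_update_add_eq` — for `Q : MvPolynomial ι R`, a ring hom `φ : R →+* S`, a point `x : ι → S`, an index `i` and `b : S`:
  `∃ r, eval₂ φ (update x i (x i + b)) Q = eval₂ φ x Q + b · eval₂ φ x (pderiv i Q) + b² · r`;
* `exists_map_eval₂_eq_of_shift` — the same read through a ring endomorphism `τ` of `S` with `τ ∘ φ = φ`, `τ (x i) = x i + b` and `τ (x j) = x j` (`j ≠ i`):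
  `∃ r, τ (eval₂ φ x Q) = eval₂ φ x Q + b · eval₂ φ x (pderiv i Q) + b² · r`.
-/

set_option linter.dupNamespace false

noncomputable section

open MvPolynomial

namespace Summit.ResolutionOfSingularities.ResolutionOfSingularities.Theorems.WildQuotientResolution.S1.FreeModel

variable {R S : Type*} [CommRing R] [CommRing S] {ι : Type*} [DecidableEq ι]

/-- **Second-order Taylor expansion in one variable direction.** [folklore] -/
theorem exists_eval₂_update_add_eq (φ : R →+* S) (x : ι → S) (i : ι) (b : S) (Q : MvPolynomial ι R) :
    ∃ r : S, eval₂ φ (Function.update x i (x i + b)) Q = eval₂ φ x Q + b * eval₂ φ x (pderiv i Q) + b ^ 2 * r := by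
  induction Q using MvPolynomial.induction_on with
  | C a => exact ⟨0, by simp [eval₂_C]⟩
  | add p q hp hq =>
    obtain ⟨r₁, h₁⟩ := hp
    obtain ⟨r₂, h₂⟩ := hq
    refine ⟨r₁ + r₂, ?_⟩
    rw [eval₂_add, eval₂_add, map_add, eval₂_add, h₁, h₂]
    ring
  | mul_X p j hp =>
    obtain ⟨r, h⟩ := hp
    by_cases hji : j = i
    · subst hji
      refine ⟨r * x j + eval₂ φ x (pderiv j p) + b * r, ?_⟩
      rw [eval₂_mul, eval₂_X, h, Function.update_self, (pderiv j).leibniz, pderiv_X_self, smul_eq_mul, smul_eq_mul, mul_one, eval₂_add, eval₂_mul,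
        eval₂_mul, eval₂_X]
      ring
    · refine ⟨r * x j, ?_⟩
      rw [eval₂_mul, eval₂_X, h, Function.update_of_ne hji, (pderiv i).leibniz, pderiv_X_of_ne hji, smul_zero, zero_add, smul_eq_mul, eval₂_mul,
        eval₂_mul, eval₂_X]
      ring

/-- **Second-order expansion of a shift read through a ring endomorphism**: `τ` fixes the coefficients and all generators but `x i`, which it shifts by `b`.
[folklore] -/
theorem exists_map_eval₂_eq_of_shift (φ : R →+* S) (x : ι → S) (i : ι) (b : S) (τ : S →+* S) (hτφ : ∀ a : R, τ (φ a) = φ a)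
    (hτi : τ (x i) = x i + b) (hτj : ∀ j, j ≠ i → τ (x j) = x j) (Q : MvPolynomial ι R) :
    ∃ r : S, τ (eval₂ φ x Q) = eval₂ φ x Q + b * eval₂ φ x (pderiv i Q) + b ^ 2 * r := by
  obtain ⟨r, hr⟩ := exists_eval₂_update_add_eq φ x i b Q
  refine ⟨r, ?_⟩
  rw [← hr, eval₂_comp_left τ φ x Q]
  have hcomp : (τ.comp φ : R →+* S) = φ := RingHom.ext hτφ
  rw [hcomp]
  congr 1
  funext j
  by_cases hj : j = i
  · subst hj; rw [Function.comp_apply, hτi, Function.update_self]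
  · rw [Function.comp_apply, hτj j hj, Function.update_of_ne hj]

end Summit.ResolutionOfSingularities.ResolutionOfSingularities.Theorems.WildQuotientResolution.S1.FreeModel

end
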